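import Mathlib
import HarnessLib
import Literature.Analysis.ODE.PoincareSection
import Literature.Analysis.FluidPDE.Tao2016AveragedNS.TaylorChainCertificate
import Summits.NavierStokesRegularity.NavierStokesRegularity.Theorems.TaylorModelRungThreeReadoutG4TransportBound

/-!
# Line `taylor-model` on crux K1b-DR (stmt-NavierStokesRegularity-23954) — stub G4 (`LandingC1`),
# helper 8: the landing point is differentiable along the entry segment, with the ΛX bound

Toward the registered stub `stub_landing : LandingC1`. For a polytope point `q` and the entry segment
`seg σ = x 0 + σ (q − x 0)`, the LANDING POINT `P σ := stAt φ j (seg σ) (tauSel (seg σ))` (state at the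
crossing time), read in window coordinates, is differentiable within `[0,1]` at every `σ`, and its
derivative `p'` has `wn p' ≤ ΛX j · dm j` (`hasDerivWithinAt_landingPoint`). Route:

* the flow restarted at node `S−1` (curve `σ ↦ c σ := stAt φ j (seg σ) (Tn (S−1))`) is a
  `Literature.Analysis.ODE.IsSolutionFamily` on `[0, h (S−1)]` with values in a closed ball, transversal to
  the section `{σf = lev}` by the certificate's γ-clause and the in-step enclosure (C3);
* `Literature.Analysis.ODE.hasFDerivWithinAt_crossingTime_poincareMap` (Wilczak–Zgliczyński §7 /
  Immler Thm 8, in the tree) gives the derivative of the Poincaré map within the node curve;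
  chain rule with the node curve, identification of the crossing time with `tauSel` (flow property);
* the bound: projection factor `1 + bb (mT+Sp)² Nσ/γ` (bilinear bound (B), `Nσ`-clause) times the frame
  transport bound `transport_bound` (helper 7), matched against the `ΛX` clause.

MODEL-lattice bookkeeping only (rung TL-M3); nothing here is a statement about the Navier–Stokes equations.
-/

noncomputable section

-- the sub-problem namespace repeats the summit name by design (D-0017)
set_option linter.dupNamespace false

namespace Summit.NavierStokesRegularity.NavierStokesRegularity.Theorems.TaylorModelReadout.G4

open scoped BigOperators Topology
open Set Filter Metric Literature.Analysis.FluidPDE.TaoCascade Literature.Analysis.FluidPDE.TaoCascade.TaylorChain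

variable {cd : CertData} {φ : Flow} {j : ℕ}

/-! ### Crossing facts along the segment -/

/-- The crossing time of a polytope point lies in the last sub-step. [folklore] -/
theorem tauSel_mem (hV : cd.Valid) (hj : j ≤ cd.N₀) (hX : Crossing cd φ (tauSel cd φ)) {q : Fin 4 → ℤ → ℝ}
    (hq : InPoly cd j q) :
    cd.Tn j (cd.S j - 1) < tauSel cd φ j q ∧ tauSel cd φ j q ≤ cd.Tn j (cd.S j) ∧
      tauSel cd φ j q - cd.Tn j (cd.S j - 1) ∈ Icc 0 (cd.h j (cd.S j - 1)) := by
  obtain ⟨h1, h2, -⟩ := hX j hj q hq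
  have hS : cd.S j - 1 + 1 = cd.S j := Nat.sub_add_cancel (G3.one_le_S hV hj)
  have hT : cd.Tn j (cd.S j) = cd.Tn j (cd.S j - 1) + cd.h j (cd.S j - 1) := by
    rw [← G3.Tn_succ hV hj (S_sub_one_lt hV hj), hS]
  exact ⟨h1, h2, ⟨by linarith, by linarith⟩⟩

/-- Two data whose trajectories agree on the last sub-step have the same `tauSel`. [folklore] -/
theorem tauSel_congr {q q' : Fin 4 → ℤ → ℝ}
    (h : ∀ t, cd.Tn j (cd.S j - 1) ≤ t → t ≤ cd.Tn j (cd.S j) → stAt φ j q t = stAt φ j q' t) :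
    tauSel cd φ j q = tauSel cd φ j q' := by
  unfold tauSel
  congr 1
  ext t
  simp only [mem_setOf_eq]
  constructor
  · rintro ⟨h1, h2, h3⟩; exact ⟨h1, h2, by rwa [← h t h1 h2]⟩
  · rintro ⟨h1, h2, h3⟩; exact ⟨h1, h2, by rwa [h t h1 h2]⟩

/-! ### The landing point along the segment -/

/-- **The landing point is differentiable along the entry segment, with the `ΛX · dm` bound.** [folklore] -/
theorem hasDerivWithinAt_landingPoint (hV : cd.Valid) (hj : j ≤ cd.N₀) (hF : IsFlowPackage cd φ)
    (hC : ChainEnclosure cd φ) (hX : Crossing cd φ (tauSel cd φ)) {q : Fin 4 → ℤ → ℝ} (hq : InPoly cd j q)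
    {σ : ℝ} (hσ : σ ∈ Icc (0:ℝ) 1) :
    ∃ p' : Fin (nW cd) → ℝ,
      HasDerivWithinAt (fun σ' => toVec cd (stAt φ j (seg cd j q σ') (tauSel cd φ j (seg cd j q σ')))) p'
        (Icc 0 1) σ ∧ wn cd j p' ≤ cd.ΛX j * cd.dm j := by
  have hω := G3.omega_pos hV hj
  -- notation
  set s := cd.S j - 1 with hsdef
  have hs : s < cd.S j := S_sub_one_lt hV hj
  have hS : s + 1 = cd.S j := Nat.sub_add_cancel (G3.one_le_S hV hj)
  set T := cd.Tn j (cd.S j) with hTdef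
  set T₀ := cd.Tn j s with hT₀def
  set hh := cd.h j s with hhdef
  have hT₀ : 0 ≤ T₀ := G3.Tn_nonneg hV hj hs.le
  have hTS : T = T₀ + hh := by rw [hTdef, ← hS]; exact G3.Tn_succ hV hj hs
  have hh0 : 0 < hh := G3.h_pos hV hj hs
  have hx0 : InPoly cd j (cd.x j 0) := inPoly_x0 hV hj
  have hsegP : ∀ σ' ∈ Icc (0:ℝ) 1, InPoly cd j (seg cd j q σ') := fun σ' hσ' => inPoly_seg hx0 hq hσ'
  have hsol : ∀ σ' ∈ Icc (0:ℝ) 1, SolvesOn cd φ j (seg cd j q σ') T := fun σ' hσ' => (hC j hj _ (hsegP σ' hσ')).1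
  -- the node curve and the restarted flow
  set c : ℝ → (Fin 4 → ℤ → ℝ) := fun σ' => stAt φ j (seg cd j q σ') T₀ with hcdef
  set Cw : ℝ → (Fin (nW cd) → ℝ) := fun σ' => toVec cd (c σ') with hCwdef
  set A : Set (Fin (nW cd) → ℝ) := Cw '' Icc 0 1 with hAdef
  have hc_w : ∀ σ', cd.Wsupp (c σ') := fun σ' => G3.wsupp_stAt hF hj _ _
  have hofC : ∀ σ', ofVec cd (Cw σ') = c σ' := fun σ' => ofVec_toVec_of_wsupp cd (hc_w σ')
  have hshift : ∀ σ' ∈ Icc (0:ℝ) 1, ∀ u ∈ Icc 0 hh, stAt φ j (c σ') u = stAt φ j (seg cd j q σ') (T₀ + u) := by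
    intro σ' hσ' u hu
    exact (G3.stAt_shift hF hj (hsol σ' hσ') hT₀ ⟨hu.1, by linarith [hu.2]⟩).symm
  have hsolc : ∀ σ' ∈ Icc (0:ℝ) 1, SolvesOn cd φ j (c σ') hh := by
    intro σ' hσ'
    have := (solvesOn_shift hF hj (hsol σ' hσ') hT₀ (by linarith)).1
    rwa [show T - T₀ = hh by linarith] at this
  have hA : ∀ x ∈ A, SolvesOn cd φ j (ofVec cd x) hh := by
    rintro _ ⟨σ', hσ', rfl⟩; rw [hofC]; exact hsolc σ' hσ'
  -- wflow on the node curve is the original trajectory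
  have hwf : ∀ σ' ∈ Icc (0:ℝ) 1, ∀ u ∈ Icc 0 hh,
      wflow cd φ j (Cw σ') u = toVec cd (stAt φ j (seg cd j q σ') (T₀ + u)) := by
    intro σ' hσ' u hu
    rw [wflow, hofC, hshift σ' hσ' u hu]
  -- a bounded convex region containing the last sub-step enclosure
  set B : ℝ := ∑ c' : Fin (nW cd), (|cd.mT j s| + |cd.Sp j s|) * wW cd j c' with hBdef
  have hBterm : ∀ c', 0 ≤ (|cd.mT j s| + |cd.Sp j s|) * wW cd j c' := fun c' =>
    mul_nonneg (add_nonneg (abs_nonneg _) (abs_nonneg _)) (wW_pos cd hω c').le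
  have hB0 : 0 ≤ B := Finset.sum_nonneg fun c' _ => hBterm c'
  have hmemS : ∀ σ' ∈ Icc (0:ℝ) 1, ∀ u ∈ Icc 0 hh, wflow cd φ j (Cw σ') u ∈ closedBall (0 : Fin (nW cd) → ℝ) B := by
    intro σ' hσ' u hu
    rw [mem_closedBall, dist_zero_right, hwf σ' hσ' u hu, pi_norm_le_iff_of_nonneg hB0]
    intro c'
    have hencl := ((hC j hj _ (hsegP σ' hσ')).2.2.1 s hs u hu).1
    have hTP := inBall_TP hV hj hs u hu
    have hsum := inBall_add hTP hencl
    rw [add_sub_cancel] at hsum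
    have h1 := (inBall_iff_toVec cd j _ _).1 hsum c'
    rw [Real.norm_eq_abs]
    calc |toVec cd (stAt φ j (seg cd j q σ') (cd.Tn j s + u)) c'| ≤ (cd.mT j s + cd.Sp j s) * wW cd j c' := h1
      _ ≤ (|cd.mT j s| + |cd.Sp j s|) * wW cd j c' :=
          mul_le_mul_of_nonneg_right (add_le_add (le_abs_self _) (le_abs_self _)) (wW_pos cd hω c').le
      _ ≤ B := Finset.single_le_sum (fun c' _ => hBterm c') (Finset.mem_univ c')
  have hfam : Literature.Analysis.ODE.IsSolutionFamily (fW cd) (closedBall 0 B) A hh (wflow cd φ j) :=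
    { init := (isSolutionFamily_wflow hA).init
      hasDerivWithinAt := (isSolutionFamily_wflow hA).hasDerivWithinAt
      mem := by rintro _ ⟨σ', hσ', rfl⟩ u hu; exact hmemS σ' hσ' u hu }
  obtain ⟨M, hM⟩ := (isCompact_closedBall (0 : Fin (nW cd) → ℝ) B).exists_bound_of_continuousOn
    (continuous_fW cd).continuousOn
  -- the section functional and transversality
  set a : (Fin (nW cd) → ℝ) →L[ℝ] ℝ := clmW cd (cd.σf j) with hadef
  have ha_fW : ∀ y : Fin 4 → ℤ → ℝ, cd.Wsupp y → a (fW cd (toVec cd y)) = cd.σf j (cd.Qb y y) := by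
    intro y hy
    rw [hadef, clmW_apply, fW, ofVec_Qw, ofVec_toVec_of_wsupp cd hy]
  have htr : ∀ x ∈ A, ∀ u ∈ Icc 0 hh, 0 < a (fW cd (wflow cd φ j x u)) := by
    rintro _ ⟨σ', hσ', rfl⟩ u hu
    rw [hwf σ' hσ' u hu, ha_fW _ (G3.wsupp_stAt hF hj _ _)]
    have hencl := ((hC j hj _ (hsegP σ' hσ')).2.2.1 s hs u hu).1
    have h := transversal hV hj u hu _ hencl
    rw [add_sub_cancel] at h
    exact lt_of_lt_of_le (γ_pos hV hj) h
  -- the crossing-time function on the node curve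
  classical
  set sfun : (Fin (nW cd) → ℝ) → ℝ := fun x =>
    if h : ∃ σ', σ' ∈ Icc (0:ℝ) 1 ∧ Cw σ' = x then tauSel cd φ j (seg cd j q h.choose) - T₀ else 0 with hsfundef
  have hsfun : ∀ σ' ∈ Icc (0:ℝ) 1, sfun (Cw σ') = tauSel cd φ j (seg cd j q σ') - T₀ := by
    intro σ' hσ'
    have hex : ∃ σ'', σ'' ∈ Icc (0:ℝ) 1 ∧ Cw σ'' = Cw σ' := ⟨σ', hσ', rfl⟩
    rw [hsfundef]; simp only [dif_pos hex]
    set σ'' := hex.choose with hσ''def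
    have hσ'' : σ'' ∈ Icc (0:ℝ) 1 ∧ Cw σ'' = Cw σ' := hex.choose_spec
    have hcc : c σ'' = c σ' := by rw [← hofC σ'', ← hofC σ', hσ''.2]
    congr 1
    refine tauSel_congr fun t ht0 ht1 => ?_
    rw [← hsdef] at ht0
    rw [← hT₀def] at ht0
    rw [← hTdef] at ht1
    have hu : t - T₀ ∈ Icc 0 hh := ⟨by linarith, by linarith⟩
    have e : t = T₀ + (t - T₀) := by ring
    rw [e, ← hshift σ'' hσ''.1 _ hu, ← hshift σ' hσ' _ hu, hcc]
  have hs_spec : ∀ x ∈ A, sfun x ∈ Icc 0 hh ∧ a (wflow cd φ j x (sfun x)) = cd.lev j := by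
    rintro _ ⟨σ', hσ', rfl⟩
    obtain ⟨-, -, hmem⟩ := tauSel_mem hV hj hX (hsegP σ' hσ')
    rw [hsfun σ' hσ']
    refine ⟨hmem, ?_⟩
    rw [hwf σ' hσ' _ hmem, hadef, clmW_apply, ofVec_toVec_of_wsupp cd (G3.wsupp_stAt hF hj _ _),
      show T₀ + (tauSel cd φ j (seg cd j q σ') - T₀) = tauSel cd φ j (seg cd j q σ') by ring]
    exact (hX j hj _ (hsegP σ' hσ')).2.2.1
  -- derivative data at the point
  have hx₀ : Cw σ ∈ A := ⟨σ, hσ, rfl⟩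
  obtain ⟨J, hJ⟩ := exists_hasFDerivWithinAt_wflow hh0.le hA
  have hτmem := (hs_spec _ hx₀).1
  obtain ⟨hDs, hDP⟩ := Literature.Analysis.ODE.hasFDerivWithinAt_crossingTime_poincareMap hfam hM
    (continuous_fW cd).continuousOn (a := a) (c := cd.lev j) htr hs_spec hx₀
    (fun u hu => continuousWithinAt_wflow hh0.le hA hx₀ hu) (hJ _ hx₀ _ hτmem)
  -- σ-derivative witnesses of the frozen-time maps along the segment
  obtain ⟨D, hD⟩ := exists_segDeriv hF hj hC hV hq
  have hCw_deriv : HasDerivWithinAt Cw (D σ T₀) (Icc 0 1) σ := hD σ hσ T₀ ⟨hT₀, by linarith⟩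
  have hmaps : MapsTo Cw (Icc (0:ℝ) 1) A := fun σ' hσ' => ⟨σ', hσ', rfl⟩
  -- the landing point along the segment
  set τσ := tauSel cd φ j (seg cd j q σ) with hτσdef
  have hτσ : T₀ < τσ ∧ τσ ≤ T := ⟨(tauSel_mem hV hj hX (hsegP σ hσ)).1, (tauSel_mem hV hj hX (hsegP σ hσ)).2.1⟩
  have hsfunσ : sfun (Cw σ) = τσ - T₀ := hsfun σ hσ
  have hcomp := hDP.comp_hasDerivWithinAt σ hCw_deriv hmaps
  -- identify J (D σ T₀) with D σ τσ (uniqueness of the frozen-time derivative within [0,1])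
  have hJD : J (Cw σ) (sfun (Cw σ)) (D σ T₀) = D σ τσ := by
    have h1 := (hJ _ hx₀ _ hτmem).comp_hasDerivWithinAt σ hCw_deriv hmaps
    have h2 : HasDerivWithinAt (fun σ' => toVec cd (stAt φ j (seg cd j q σ') τσ)) (J (Cw σ) (sfun (Cw σ)) (D σ T₀))
        (Icc 0 1) σ := by
      refine h1.congr_of_mem (fun σ' hσ' => ?_) hσ
      simp only [Function.comp_apply]
      rw [hsfunσ, hwf σ' hσ' _ (by rw [← hsfunσ]; exact hτmem), show T₀ + (τσ - T₀) = τσ by ring]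
    exact (uniqueDiffOn_Icc zero_lt_one σ hσ).eq_deriv _ h2 (hD σ hσ τσ ⟨hT₀.trans hτσ.1.le, hτσ.2⟩)
  -- the derivative of the landing point
  set P₀ := stAt φ j (seg cd j q σ) τσ with hP₀def
  have hP₀w : cd.Wsupp P₀ := G3.wsupp_stAt hF hj _ _
  have hwfP₀ : wflow cd φ j (Cw σ) (sfun (Cw σ)) = toVec cd P₀ := by
    rw [hsfunσ, hwf σ hσ _ (by rw [← hsfunσ]; exact hτmem), show T₀ + (τσ - T₀) = τσ by ring]
  set m := a (fW cd (wflow cd φ j (Cw σ) (sfun (Cw σ)))) with hmdef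
  clear_value m
  set p' : Fin (nW cd) → ℝ := D σ τσ - (m⁻¹ * a (D σ τσ)) • fW cd (toVec cd P₀) with hp'def
  clear_value p'
  refine ⟨p', ?_, ?_⟩
  · -- the derivative statement
    have hval : (J (Cw σ) (sfun (Cw σ)) - m⁻¹ • (a.comp (J (Cw σ) (sfun (Cw σ)))).smulRight
        (fW cd (wflow cd φ j (Cw σ) (sfun (Cw σ))))) (D σ T₀) = p' := by
      rw [hp'def, _root_.sub_apply, _root_.smul_apply,
        ContinuousLinearMap.smulRight_apply, ContinuousLinearMap.comp_apply, hJD, hwfP₀, smul_smul]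
    rw [hval] at hcomp
    refine hcomp.congr_of_mem (fun σ' hσ' => ?_) hσ
    simp only [Function.comp_apply]
    obtain ⟨-, -, hmem'⟩ := tauSel_mem hV hj hX (hsegP σ' hσ')
    rw [hsfun σ' hσ', hwf σ' hσ' _ hmem', show T₀ + (tauSel cd φ j (seg cd j q σ') - T₀) =
      tauSel cd φ j (seg cd j q σ') by ring]
  · -- the bound
    have hm : cd.γ j ≤ m := by
      rw [hmdef, hwfP₀, ha_fW _ hP₀w]
      have hencl := (hX j hj _ (hsegP σ hσ)).2.2.2.2.1
      have h := transversal hV hj _ (tauSel_mem hV hj hX (hsegP σ hσ)).2.2 _ hencl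
      rwa [add_sub_cancel] at h
    have hγ := γ_pos hV hj
    have hm0 : 0 < m := lt_of_lt_of_le hγ hm
    -- |a (D σ τσ)| ≤ Nσ · wn
    have haD : |a (D σ τσ)| ≤ cd.Nσ j * wn cd j (D σ τσ) := by
      rw [hadef, clmW_apply]
      exact scale_ball (j := j) (f := fun v => cd.σf j v) (fun r v => by rw [map_smul, smul_eq_mul]) (σf_bound hV hj)
        (wsupp_ofVec cd _) (wn_nonneg j _) (inBall_ofVec_wn hω _)
    -- wn (fW (toVec P₀)) ≤ bb (mT + Sp)^2
    have hPball : cd.InBall j P₀ (cd.mT j s + cd.Sp j s) := by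
      have hencl := (hX j hj _ (hsegP σ hσ)).2.2.2.2.1
      have hTP := inBall_TP hV hj hs _ (tauSel_mem hV hj hX (hsegP σ hσ)).2.2
      have := inBall_add hTP hencl
      rwa [add_sub_cancel] at this
    have hR0 : 0 ≤ cd.mT j s + cd.Sp j s := nonneg_of_inBall hω hPball (one_mem_window hV) cd.i₀
    have hfP : wn cd j (fW cd (toVec cd P₀)) ≤ cd.bb j * (cd.mT j s + cd.Sp j s) ^ 2 := by
      rw [fW, Qw_toVec]
      have h := Qb_bound hV hj P₀ P₀ _ _ hR0 hR0 hPball hPball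
      have hnn : 0 ≤ cd.bb j * (cd.mT j s + cd.Sp j s) * (cd.mT j s + cd.Sp j s) :=
        mul_nonneg (mul_nonneg (G3.bb_nonneg hV hj) hR0) hR0
      have := wn_toVec_le hω hnn h
      rw [sq, ← mul_assoc]; exact this
    -- assemble the projection factor
    have hNσ : 0 ≤ cd.Nσ j := by
      have := σf_bound hV hj 0 (G3.inBall_zero hω zero_le_one)
      rw [map_zero, abs_zero] at this; exact this
    have hwD := wn_nonneg j (D σ τσ)
    have h1 : wn cd j p' ≤ wn cd j (D σ τσ) * (1 + cd.bb j * (cd.mT j s + cd.Sp j s) ^ 2 * cd.Nσ j / cd.γ j) := by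
      have t1 : m⁻¹ * |a (D σ τσ)| ≤ (cd.γ j)⁻¹ * (cd.Nσ j * wn cd j (D σ τσ)) :=
        mul_le_mul (inv_anti₀ hγ hm) haD (abs_nonneg _) (inv_nonneg.2 hγ.le)
      have t2 : m⁻¹ * |a (D σ τσ)| * wn cd j (fW cd (toVec cd P₀)) ≤
          (cd.γ j)⁻¹ * (cd.Nσ j * wn cd j (D σ τσ)) * (cd.bb j * (cd.mT j s + cd.Sp j s) ^ 2) :=
        mul_le_mul t1 hfP (wn_nonneg j _) (mul_nonneg (inv_nonneg.2 hγ.le) (mul_nonneg hNσ hwD))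
      calc wn cd j p' ≤ wn cd j (D σ τσ) + wn cd j ((m⁻¹ * a (D σ τσ)) • fW cd (toVec cd P₀)) := by
              rw [hp'def]; exact wn_sub_le j _ _
        _ = wn cd j (D σ τσ) + m⁻¹ * |a (D σ τσ)| * wn cd j (fW cd (toVec cd P₀)) := by
            rw [wn_smul, abs_mul, abs_inv, abs_of_pos hm0]
        _ ≤ wn cd j (D σ τσ) + (cd.γ j)⁻¹ * (cd.Nσ j * wn cd j (D σ τσ)) * (cd.bb j * (cd.mT j s + cd.Sp j s) ^ 2) := by
            linarith [t2]
        _ = wn cd j (D σ τσ) * (1 + cd.bb j * (cd.mT j s + cd.Sp j s) ^ 2 * cd.Nσ j / cd.γ j) := by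
            rw [div_eq_mul_inv]; ring
    -- the transport bound and the ΛX clause
    have htb := transport_bound hj hV hF hC hq hD hσ hτσ.1.le hτσ.2
    have hsle : s ≤ cd.S j - 1 := le_of_eq hsdef
    obtain ⟨hlam, -⟩ := wn_segDeriv_node hj hV hF hC hq hD hσ hsle
    have hΛX := ΛX_clause hV hj
    have hfac : 0 ≤ 1 + cd.bb j * (cd.mT j s + cd.Sp j s) ^ 2 * cd.Nσ j / cd.γ j := by
      have := G3.bb_nonneg hV hj; positivity
    have hρE : 0 ≤ cd.ρO j s - cd.EO j s := sub_nonneg.2 (EO_le_ρO hV hj hs.le)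
    have hL1 : 0 ≤ cd.L1 j s := (one_div_sq_nonneg _).trans (L1_exit hV hj s hs)
    have hdm := dm_nonneg hV hj
    calc wn cd j p' ≤ wn cd j (D σ τσ) * (1 + cd.bb j * (cd.mT j s + cd.Sp j s) ^ 2 * cd.Nσ j / cd.γ j) := h1
      _ ≤ (cd.L1 j s * ((cd.NCi j 0 * cd.dm j * ∏ u' ∈ Finset.range s, (1 + cd.κB j u')) * (cd.ρO j s - cd.EO j s))) *
            (1 + cd.bb j * (cd.mT j s + cd.Sp j s) ^ 2 * cd.Nσ j / cd.γ j) := mul_le_mul_of_nonneg_right htb hfac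
      _ = ((1 + cd.bb j * (cd.mT j s + cd.Sp j s) ^ 2 * cd.Nσ j / cd.γ j) *
            (cd.NCi j 0 * (∏ u ∈ Finset.Ico 0 s, (1 + cd.κB j u)) * (cd.ρO j s - cd.EO j s)) * cd.L1 j s) * cd.dm j := by
            rw [Finset.range_eq_Ico]; ring
      _ ≤ cd.ΛX j * cd.dm j := mul_le_mul_of_nonneg_right hΛX hdm

end Summit.NavierStokesRegularity.NavierStokesRegularity.Theorems.TaylorModelReadout.G4

end
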